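import Literature.Analysis.Asymptotics.LaplaceAtomsContinuity
import Literature.Analysis.Asymptotics.LaplaceAtomsDyadicRatio
import HarnessLib

/-!
# Sorted atoms from dyadic ratios of Laplace transforms (assembly)

Topic `Literature/Analysis/Asymptotics`. Everything here is PROVED (no `sorry`, no definition, no named
fact); this file only assembles its two imports:

* `LaplaceAtomsDyadicRatio.tendsto_tsum_exp_of_tendsto_ratio` — convergence of the scale-free dyadic
  ratios `r(s) = ω(2s)/ω(s)²` of the Laplace transforms `ω_{a n}(s) = Σ_k e^{-s a_n(k)}` of sorted atomic
  spectra with bottom atom `0`, at every `s > 0` along some evaluation points `σ_n → s`, forces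
  convergence of the transforms themselves, `ω_{a n}(s) → ω_Δ(s)` (`s > 0`);
* `LaplaceAtomsContinuity.tendsto_atom_of_tendsto_tsum_exp` — the sorted-atomic form of Feller's
  extended continuity theorem [Feller XIII.1 Thm 2a: "If `ω_n(λ) → ω(λ)` for `λ > a`, then `ω` is the
  Laplace transform of a measure `U` and `U_n → U`"]: convergence of the transforms for every `s > 0`
  forces convergence of every sorted atom, `a_n(k) → Δ(k)`.

The composite `tendsto_atom_of_tendsto_ratio` / `laplaceAtoms` reads: *if the dyadic ratios of a
sequence of atomic spectra `a n` (bottom atom at `0`, non-decreasing, Laplace-summable) converge, at every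
`s > 0` along SOME evaluation points `σ_n → s`, to those of a fixed summable spectrum `Δ`, then every
atom converges, `a n k → Δ k`.* In applications `r` is a ratio of partition functions `Z(2T)/Z(T)²` on
tori of time extents `2T` and `T` (the ground-state energy cancels identically), known only at lattice
times `T = ⌈s/ε_n⌉`, whence the evaluation points `σ_n = Tε_n → s`.

## References
* [Feller1971] W. Feller, *An Introduction to Probability Theory and Its Applications, Vol. II*, 2nd ed.,
  Wiley 1971, ch. XIII §1, Theorem 2a (extended continuity theorem) (held, p0422).
-/

namespace Literature.Analysis.Asymptotics.LaplaceAtoms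

open Filter
open scoped _root_.Topology

/-- **Sorted atoms from dyadic ratios.** `Δ`, `a n` non-decreasing with `Δ 0 = a n 0 = 0` and
`Σ_k e^{-s Δ(k)}`, `Σ_k e^{-s a_n(k)}` convergent for all `s > 0`; if for every `s > 0` there are
`σ_n → s` with `ω_{a n}(2σ_n)/ω_{a n}(σ_n)² → ω_Δ(2s)/ω_Δ(s)²`, then `a_n(k) → Δ(k)` for every `k`.
[cite: Feller1971, Ch. XIII §1 Thm 2a] -/
theorem tendsto_atom_of_tendsto_ratio {Δ : ℕ → ℝ} {a : ℕ → ℕ → ℝ}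
    (hΔ0 : Δ 0 = 0) (hΔ : Monotone Δ)
    (hΔs : ∀ s : ℝ, 0 < s → Summable fun k => Real.exp (-s * Δ k))
    (ha0 : ∀ n, a n 0 = 0) (ha : ∀ n, Monotone (a n))
    (has : ∀ n (s : ℝ), 0 < s → Summable fun k => Real.exp (-s * a n k))
    (hr : ∀ s : ℝ, 0 < s → ∃ σ : ℕ → ℝ, Tendsto σ atTop (𝓝 s) ∧
      Tendsto (fun n => (∑' k, Real.exp (-(2 * σ n) * a n k)) /
        (∑' k, Real.exp (-σ n * a n k)) ^ 2) atTop
        (𝓝 ((∑' k, Real.exp (-(2 * s) * Δ k)) / (∑' k, Real.exp (-s * Δ k)) ^ 2)))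
    (k : ℕ) : Tendsto (fun n => a n k) atTop (𝓝 (Δ k)) :=
  tendsto_atom_of_tendsto_tsum_exp hΔ ha hΔs has
    (fun s hs => tendsto_tsum_exp_of_tendsto_ratio hΔ0 hΔ hΔs ha0 ha has hr s hs) k

/-- **Sorted atoms from dyadic ratios**, closed `∀`-form (all binders explicit, hypotheses as
implications) — the shape in which the statement is consumed as a named `Prop`.
[cite: Feller1971, Ch. XIII §1 Thm 2a] -/
theorem laplaceAtoms :
    ∀ (Δ : ℕ → ℝ) (a : ℕ → ℕ → ℝ),
      Δ 0 = 0 → Monotone Δ → (∀ s : ℝ, 0 < s → Summable fun k : ℕ => Real.exp (-s * Δ k)) →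
      (∀ n, a n 0 = 0) → (∀ n, Monotone (a n)) →
      (∀ n (s : ℝ), 0 < s → Summable fun k : ℕ => Real.exp (-s * a n k)) →
      (∀ s : ℝ, 0 < s → ∃ σ : ℕ → ℝ, Tendsto σ atTop (𝓝 s) ∧
          Tendsto (fun n => (∑' k : ℕ, Real.exp (-(2 * σ n) * a n k)) /
            (∑' k : ℕ, Real.exp (-σ n * a n k)) ^ 2) atTop
            (𝓝 ((∑' k : ℕ, Real.exp (-(2 * s) * Δ k)) /
              (∑' k : ℕ, Real.exp (-s * Δ k)) ^ 2))) →
      ∀ k : ℕ, Tendsto (fun n => a n k) atTop (𝓝 (Δ k)) :=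
  fun _ _ hΔ0 hΔ hΔs ha0 ha has hr k => tendsto_atom_of_tendsto_ratio hΔ0 hΔ hΔs ha0 ha has hr k

end Literature.Analysis.Asymptotics.LaplaceAtoms
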